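import Mathlib
import HarnessLib

/-!
# The TOP-DOWN RECURSION WITH A `√L` DEFECT: `B_t ≤ √L·B_{t+1} + R_t`, `B_m = 0` ⟹ `B_0 ≤ Σ_{t<m} L^{t/2}·R_t`,
# and with `R_t ≤ C·L^{t/2}·F`: `B_0 ≤ C·F·(L^m − 1)/(L − 1) ≤ C·F·N/(L − 1)` — depth enters only through `N = L^m`

Width seat `ym3-torus-px16` (gen 20); `--kind proof --supports stmt-QuantumFields-20520 --as helper`, count-neutral,
DEFINITION-FREE (0 `def`, 0 `instance`, 0 `notation`, default heartbeats).  Mathlib-only real analysis.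

Bears on crux stmt-QuantumFields-20520 `FluctuationComparisonRegPrIntL`, LINE `semiclassical_s2beta`, registered
stub GAP♯∘ `stub_uniformFibreGapOrbit` through the depth-uniform flat letter `hFlat` (UV3-NODE §53–§54): on the
TELESCOPED road (px8 g21, UV3-NODE §57, §57.8 (B) «the nonlinear assembly is a recursion, not a formula») the final
assembly is the real-sequence bookkeeping typed here — brick (iv) of §57.8 (D).  After the iterated residual axial
gauge (i), the geodesic Jensen lift (ii-a, exact factor `√L` — §53.3's criticality met on the nose) and the one-level
relative-field and key-lemma letters (ii-b), (iii-a), (iii-b), one has for the level-`t` flux norms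
`B_t := ‖d_g(U′_t)‖_{ℓ²}`: `B_m = 0` (fibre of the flat datum), `B_t ≤ √L·B_{t+1} + R_t` (top-down, `t = m−1, …, 0`)
and `R_t ≤ C(L)·L^{t/2}·‖f‖`; this file turns that into `B_0 ≤ C(L)·‖f‖·(L^m − 1)/(L − 1)` and the `hFlat`-currency
square `((L−1)/C)²·(L^m)⁻²·B_0² ≤ ‖f‖²` — ADDITIVE over the scales, the top scale dominant, depth entering only
through `N = L^m` (never a product `(1+ε)^m`).

What is proved (all elementary; `q` plays `√L`):
* §1 `recursion_le_pow_mul_add_sum`: `B s ≤ q^k·B (s+k) + Σ_{i<k} q^i·R (s+i)` for `0 ≤ q` and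
  `∀ t, B t ≤ q·B (t+1) + R t` on the range (the general top-down solution);
  ★`recursion_le_sum_of_top_eq_zero`: `B m = 0 ⟹ B 0 ≤ Σ_{t<m} q^t·R t`.
* §2 ★`recursion_le_geom_of_top_eq_zero`: with `R t ≤ C·q^t·F` (`0 ≤ C`, `0 ≤ F`): `B 0 ≤ C·F·Σ_{t<m} (q^2)^t`;
  ★★`recursion_sqrtL_le` (`q := √L`, `1 < L`): `B 0 ≤ C·F·((L^m − 1)/(L − 1))`, `recursion_sqrtL_le_pow`:
  `B 0 ≤ C·F·L^m/(L − 1)`; `recursion_sqrtL_two_term` (the §57.8 shape `R t ≤ C·(φ t + φ (t+1))`,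
  `φ t ≤ C′·(√L)^t·F`).
* §3 ★★`hFlat_currency_of_recursion`: `((L − 1)/C)^2·(L^m)⁻¹^2·B 0^2 ≤ F^2` — the shape
  `μ·(L⁻¹)^{2m}·(orbit functional) ≤ (action)` of the registered letter once `B_0²` dominates the orbit functional
  and `F² ≤ c·A`.
* §4 (px8 g21's wish (w)) the CODEPTH edition, no index flip for the assembler: ★`recursion_codepth_le_sum`
  (`D 0 = 0`, `D (k+1) ≤ q·D k + R′ k` ⟹ `D m ≤ Σ_{k<m} q^(m−1−k)·R′ k`), ★★`recursion_codepth_sqrtL_le`,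
  `hFlat_currency_codepth`.

HONEST: real-sequence algebra; NOTHING of Bałaban's analysis is asserted or proved; the letters (i)–(iii) it is meant
to be fed with are NOT in the tree; `hFlat`, GAP♯∘ (v11.4), S2β, crux 20520 and `YM3TorusSU2` are NOT proved; no
registered stub is closed; rung R3 = SU(2) YM₃ on T³ at fixed lattice data — NOT d = 4, NOT infinite volume, NOT a
mass gap, NOT Clay; the Yang–Mills mass gap is NOT proved.  Sorry-free, axioms standard.

References: [Balaban1984PropagatorsII] (1.33) (the quadratic floor this bookkeeping serves, at the flat datum);
[Balaban1985RegularSpaces] Lemma 1 (1.24)–(1.26) pp.79–80 (the iterated axial gauge whose levelwise smallness makes the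
recursion's inputs available at every depth).
-/

set_option autoImplicit false

open Finset
open scoped BigOperators

namespace Summit.QuantumFields.YangMills.Theorems.FluctuationComparisonRegPrIntLS2BetaSqrtLRecursion

/-! ## §1. The general top-down solution -/

/-- the top-down recursion solved over `k` steps: if `B t ≤ q·B (t+1) + R t` for all `t` with `s ≤ t < s + k` and
`0 ≤ q`, then `B s ≤ q^k·B (s+k) + Σ_{i<k} q^i·R (s+i)`. [folklore] -/
theorem recursion_le_pow_mul_add_sum (q : ℝ) (hq : 0 ≤ q) (B R : ℕ → ℝ) (s k : ℕ)
    (hrec : ∀ t, s ≤ t → t < s + k → B t ≤ q * B (t + 1) + R t) :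
    B s ≤ q ^ k * B (s + k) + ∑ i ∈ range k, q ^ i * R (s + i) := by
  induction k with
  | zero => simp
  | succ k ih =>
    have h1 : B s ≤ q ^ k * B (s + k) + ∑ i ∈ range k, q ^ i * R (s + i) :=
      ih (fun t ht1 ht2 => hrec t ht1 (by omega))
    have h0 : B (s + k) ≤ q * B (s + k + 1) + R (s + k) := hrec (s + k) (by omega) (by omega)
    have hqk : 0 ≤ q ^ k := pow_nonneg hq k
    have h2 : q ^ k * B (s + k) ≤ q ^ k * (q * B (s + k + 1) + R (s + k)) :=
      mul_le_mul_of_nonneg_left h0 hqk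
    have h3 : q ^ k * (q * B (s + k + 1) + R (s + k)) = q ^ k * q * B (s + k + 1) + q ^ k * R (s + k) := by
      ring
    rw [Finset.sum_range_succ, pow_succ]
    have e1 : s + (k + 1) = s + k + 1 := by omega
    rw [e1]
    linarith [h1, h2, h3]

/-- ★ THE TOP-DOWN RECURSION WITH VANISHING TOP: `B m = 0`, `B t ≤ q·B (t+1) + R t` for `t < m`, `0 ≤ q`
⟹ `B 0 ≤ Σ_{t<m} q^t·R t`. [folklore] -/
theorem recursion_le_sum_of_top_eq_zero (q : ℝ) (hq : 0 ≤ q) (B R : ℕ → ℝ) (m : ℕ) (hB : B m = 0)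
    (hrec : ∀ t, t < m → B t ≤ q * B (t + 1) + R t) :
    B 0 ≤ ∑ t ∈ range m, q ^ t * R t := by
  have h := recursion_le_pow_mul_add_sum q hq B R 0 m (fun t _ ht => hrec t (by omega))
  simp only [zero_add, hB, mul_zero] at h
  exact h

/-! ## §2. Geometric inputs: `R t ≤ C·q^t·F` -/

/-- ★ with geometric inputs `R t ≤ C·q^t·F` the solution is a geometric sum in `q²`:
`B 0 ≤ C·F·Σ_{t<m} (q²)^t`. [folklore] -/
theorem recursion_le_geom_of_top_eq_zero (q : ℝ) (hq : 0 ≤ q) (B R : ℕ → ℝ) (m : ℕ) (hB : B m = 0)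
    (hrec : ∀ t, t < m → B t ≤ q * B (t + 1) + R t) (C F : ℝ)
    (hR : ∀ t, t < m → R t ≤ C * q ^ t * F) :
    B 0 ≤ C * F * ∑ t ∈ range m, (q ^ 2) ^ t := by
  have h := recursion_le_sum_of_top_eq_zero q hq B R m hB hrec
  refine h.trans ?_
  rw [Finset.mul_sum]
  refine Finset.sum_le_sum fun t ht => ?_
  have ht' : t < m := Finset.mem_range.mp ht
  have hqt : 0 ≤ q ^ t := pow_nonneg hq t
  calc q ^ t * R t ≤ q ^ t * (C * q ^ t * F) := mul_le_mul_of_nonneg_left (hR t ht') hqt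
    _ = C * F * (q ^ 2) ^ t := by rw [← pow_mul, mul_comm 2 t, pow_mul]; ring

/-- `Σ_{t<m} L^t = (L^m − 1)/(L − 1)` for `L ≠ 1` (Mathlib's `geom_sum_eq`, restated in the orientation used
here). [folklore] -/
theorem geom_sum_eq_div (L : ℝ) (hL : L ≠ 1) (m : ℕ) : ∑ t ∈ range m, L ^ t = (L ^ m - 1) / (L - 1) :=
  geom_sum_eq hL m

/-- `(L^m − 1)/(L − 1) ≤ L^m/(L − 1)` for `1 < L`. [folklore] -/
theorem geom_sum_le_pow_div (L : ℝ) (hL : 1 < L) (m : ℕ) : ∑ t ∈ range m, L ^ t ≤ L ^ m / (L - 1) := by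
  rw [geom_sum_eq_div L (ne_of_gt hL) m]
  have hL1 : 0 < L - 1 := by linarith
  exact div_le_div_of_nonneg_right (by linarith) hL1.le

/-- ★★ THE `√L` RECURSION: `B m = 0`, `B t ≤ √L·B (t+1) + R t`, `R t ≤ C·(√L)^t·F` (`0 ≤ C`, `0 ≤ F`, `1 < L`)
⟹ `B 0 ≤ C·F·(L^m − 1)/(L − 1)` — the additive-over-scales assembly of UV3-NODE §57.3∕§57.8 (B): depth enters only
through `L^m`. [folklore] -/
theorem recursion_sqrtL_le (L : ℝ) (hL : 1 < L) (B R : ℕ → ℝ) (m : ℕ) (hB : B m = 0)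
    (hrec : ∀ t, t < m → B t ≤ Real.sqrt L * B (t + 1) + R t) (C F : ℝ)
    (hR : ∀ t, t < m → R t ≤ C * Real.sqrt L ^ t * F) :
    B 0 ≤ C * F * ((L ^ m - 1) / (L - 1)) := by
  have hL0 : 0 ≤ L := by linarith
  have h := recursion_le_geom_of_top_eq_zero (Real.sqrt L) (Real.sqrt_nonneg L) B R m hB hrec C F hR
  rw [Real.sq_sqrt hL0, geom_sum_eq_div L (ne_of_gt hL) m] at h
  exact h

/-- the same with the cruder bound `L^m/(L − 1)` (needs `0 ≤ C·F`). [folklore] -/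
theorem recursion_sqrtL_le_pow (L : ℝ) (hL : 1 < L) (B R : ℕ → ℝ) (m : ℕ) (hB : B m = 0)
    (hrec : ∀ t, t < m → B t ≤ Real.sqrt L * B (t + 1) + R t) (C F : ℝ) (hC : 0 ≤ C) (hF : 0 ≤ F)
    (hR : ∀ t, t < m → R t ≤ C * Real.sqrt L ^ t * F) :
    B 0 ≤ C * F * (L ^ m / (L - 1)) := by
  have hL0 : 0 ≤ L := by linarith
  have h := recursion_le_geom_of_top_eq_zero (Real.sqrt L) (Real.sqrt_nonneg L) B R m hB hrec C F hR
  rw [Real.sq_sqrt hL0] at h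
  exact h.trans (mul_le_mul_of_nonneg_left (geom_sum_le_pow_div L hL m) (mul_nonneg hC hF))

/-- the TWO-TERM input shape of §57.8 (B)∕(C): `R t ≤ C·(φ t + φ (t+1))` with `φ t ≤ C′·(√L)^t·F` for `t ≤ m`
gives `R t ≤ (C·C′·(1 + √L))·(√L)^t·F`, i.e. the geometric input of `recursion_sqrtL_le` with constant
`C·C′·(1 + √L)`. [folklore] -/
theorem two_term_le_geom (L : ℝ) (R φ : ℕ → ℝ) (m : ℕ) (C C' F : ℝ) (hC : 0 ≤ C)
    (hR : ∀ t, t < m → R t ≤ C * (φ t + φ (t + 1))) (hφ : ∀ t, t ≤ m → φ t ≤ C' * Real.sqrt L ^ t * F) :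
    ∀ t, t < m → R t ≤ (C * C' * (1 + Real.sqrt L)) * Real.sqrt L ^ t * F := by
  intro t ht
  have hq : 0 ≤ Real.sqrt L := Real.sqrt_nonneg L
  have h1 : φ t ≤ C' * Real.sqrt L ^ t * F := hφ t ht.le
  have h2 : φ (t + 1) ≤ C' * Real.sqrt L ^ (t + 1) * F := hφ (t + 1) (by omega)
  have hqt : 0 ≤ Real.sqrt L ^ t := pow_nonneg hq t
  calc R t ≤ C * (φ t + φ (t + 1)) := hR t ht
    _ ≤ C * (C' * Real.sqrt L ^ t * F + C' * Real.sqrt L ^ (t + 1) * F) := by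
        exact mul_le_mul_of_nonneg_left (add_le_add h1 h2) hC
    _ = (C * C' * (1 + Real.sqrt L)) * Real.sqrt L ^ t * F := by rw [pow_succ]; ring

/-- ★★ the two-term edition assembled: `B m = 0`, `B t ≤ √L·B (t+1) + R t`, `R t ≤ C·(φ t + φ (t+1))`,
`φ t ≤ C′·(√L)^t·F` ⟹ `B 0 ≤ C·C′·(1 + √L)·F·(L^m − 1)/(L − 1)`. [folklore] -/
theorem recursion_sqrtL_two_term (L : ℝ) (hL : 1 < L) (B R φ : ℕ → ℝ) (m : ℕ) (hB : B m = 0)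
    (hrec : ∀ t, t < m → B t ≤ Real.sqrt L * B (t + 1) + R t) (C C' F : ℝ) (hC : 0 ≤ C)
    (hR : ∀ t, t < m → R t ≤ C * (φ t + φ (t + 1)))
    (hφ : ∀ t, t ≤ m → φ t ≤ C' * Real.sqrt L ^ t * F) :
    B 0 ≤ (C * C' * (1 + Real.sqrt L)) * F * ((L ^ m - 1) / (L - 1)) :=
  recursion_sqrtL_le L hL B R m hB hrec _ F (two_term_le_geom L R φ m C C' F hC hR hφ)

/-! ## §3. The `hFlat` currency -/

/-- ★★ THE `hFlat` CURRENCY OF THE RECURSION: from `0 ≤ B 0 ≤ C·F·L^m/(L − 1)` with `0 < C`, `1 < L` (no sign needed on `F`):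
`((L − 1)/C)²·((L^m)⁻¹)²·(B 0)² ≤ F²` — the shape `μ·(L⁻¹)^{2m}·(orbit functional) ≤ (flux²)` of the registered
flat letter, with `μ = ((L−1)/C)²` free of `m`. [folklore] -/
theorem hFlat_currency_of_recursion (L C F B0 : ℝ) (m : ℕ) (hL : 1 < L) (hC : 0 < C)
    (hB0 : 0 ≤ B0) (h : B0 ≤ C * F * (L ^ m / (L - 1))) :
    ((L - 1) / C) ^ 2 * ((L ^ m)⁻¹) ^ 2 * B0 ^ 2 ≤ F ^ 2 := by
  have hL1 : 0 < L - 1 := by linarith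
  have hLm : 0 < L ^ m := pow_pos (by linarith) m
  -- rescale: `((L−1)/C)·(L^m)⁻¹·B0 ≤ F`
  have h1 : (L - 1) / C * (L ^ m)⁻¹ * B0 ≤ F := by
    have h2 : (L - 1) / C * (L ^ m)⁻¹ * (C * F * (L ^ m / (L - 1))) = F := by
      field_simp
    have h3 : 0 ≤ (L - 1) / C * (L ^ m)⁻¹ := by positivity
    calc (L - 1) / C * (L ^ m)⁻¹ * B0 ≤ (L - 1) / C * (L ^ m)⁻¹ * (C * F * (L ^ m / (L - 1))) :=
          mul_le_mul_of_nonneg_left h h3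
      _ = F := h2
  have h0 : 0 ≤ (L - 1) / C * (L ^ m)⁻¹ * B0 := by positivity
  have h4 : ((L - 1) / C * (L ^ m)⁻¹ * B0) ^ 2 ≤ F ^ 2 := pow_le_pow_left₀ h0 h1 2
  calc ((L - 1) / C) ^ 2 * ((L ^ m)⁻¹) ^ 2 * B0 ^ 2 = ((L - 1) / C * (L ^ m)⁻¹ * B0) ^ 2 := by ring
    _ ≤ F ^ 2 := h4

/-- the same in the `(L⁻¹)^(2m)` spelling of the registered letter: `((L^m)⁻¹)² = (L⁻¹)^(2m)`. [folklore] -/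
theorem inv_pow_sq_eq (L : ℝ) (m : ℕ) : ((L ^ m)⁻¹) ^ 2 = (L⁻¹) ^ (2 * m) := by
  rw [← inv_pow, ← pow_mul, mul_comm]

/-- ★★ `hFlat`-shaped conclusion: `((L − 1)/C)²·(L⁻¹)^(2m)·B0² ≤ F²`. [folklore] -/
theorem hFlat_currency_of_recursion' (L C F B0 : ℝ) (m : ℕ) (hL : 1 < L) (hC : 0 < C)
    (hB0 : 0 ≤ B0) (h : B0 ≤ C * F * (L ^ m / (L - 1))) :
    ((L - 1) / C) ^ 2 * (L⁻¹) ^ (2 * m) * B0 ^ 2 ≤ F ^ 2 := by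
  rw [← inv_pow_sq_eq]
  exact hFlat_currency_of_recursion L C F B0 m hL hC hB0 h

/-! ## §4. The codepth edition (px8 g21's wish (w): no index flip for the assembler)

The same recursion read BOTTOM-UP in the codepth `k = m − t` (px10 g21's iterated-gauge files index by height
`j` with the TOP at `j = K − J`; §57.8 (B) runs `t = m−1, …, 0`): `D 0 = 0` at the top, `D (k+1) ≤ q·D k + R′ k`,
conclusion at the finest level `D m`. -/

/-- ★ CODEPTH RECURSION: `D 0 = 0`, `D (k+1) ≤ q·D k + R′ k` for `k < m`, `0 ≤ q` ⟹
`D m ≤ Σ_{k<m} q^(m−1−k)·R′ k`. [folklore] -/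
theorem recursion_codepth_le_sum (q : ℝ) (hq : 0 ≤ q) (D R' : ℕ → ℝ) (m : ℕ) (hD : D 0 = 0)
    (hrec : ∀ k, k < m → D (k + 1) ≤ q * D k + R' k) :
    D m ≤ ∑ k ∈ range m, q ^ (m - 1 - k) * R' k := by
  -- height reading: `B t := D (m − t)`, `R t := R′ (m − 1 − t)`
  have h := recursion_le_sum_of_top_eq_zero q hq (fun t => D (m - t)) (fun t => R' (m - 1 - t)) m
    (by simp [hD]) (by
      intro t ht
      have e1 : m - t = (m - (t + 1)) + 1 := by omega
      have e2 : m - 1 - t = m - (t + 1) := by omega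
      show D (m - t) ≤ q * D (m - (t + 1)) + R' (m - 1 - t)
      rw [e1, e2]
      exact hrec (m - (t + 1)) (by omega))
  simp only [Nat.sub_zero] at h
  refine h.trans (le_of_eq ?_)
  rw [← Finset.sum_range_reflect]
  refine Finset.sum_congr rfl fun k hk => ?_
  have hk' : k < m := Finset.mem_range.mp hk
  have e3 : m - 1 - (m - 1 - k) = k := by omega
  rw [e3]

/-- ★★ CODEPTH `√L` RECURSION with geometric inputs read from the top: `D 0 = 0`,
`D (k+1) ≤ √L·D k + R′ k`, `R′ k ≤ C·(√L)^(m−1−k)·F` (`1 < L`) ⟹ `D m ≤ C·F·(L^m − 1)/(L − 1)`. [folklore] -/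
theorem recursion_codepth_sqrtL_le (L : ℝ) (hL : 1 < L) (D R' : ℕ → ℝ) (m : ℕ) (hD : D 0 = 0)
    (hrec : ∀ k, k < m → D (k + 1) ≤ Real.sqrt L * D k + R' k) (C F : ℝ)
    (hR : ∀ k, k < m → R' k ≤ C * Real.sqrt L ^ (m - 1 - k) * F) :
    D m ≤ C * F * ((L ^ m - 1) / (L - 1)) := by
  have hB : (fun t => D (m - t)) m = 0 := by simp [hD]
  have h := recursion_sqrtL_le L hL (fun t => D (m - t)) (fun t => R' (m - 1 - t)) m hB
    (by
      intro t ht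
      have e1 : m - t = (m - (t + 1)) + 1 := by omega
      have e2 : m - 1 - t = m - (t + 1) := by omega
      show D (m - t) ≤ Real.sqrt L * D (m - (t + 1)) + R' (m - 1 - t)
      rw [e1, e2]
      exact hrec (m - (t + 1)) (by omega))
    C F (by
      intro t ht
      have e3 : m - 1 - (m - 1 - t) = t := by omega
      have h1 := hR (m - 1 - t) (by omega)
      rw [e3] at h1
      exact h1)
  simpa using h

/-- the codepth `hFlat` currency: `0 ≤ D m ≤ C·F·L^m/(L − 1)` ⟹ `((L − 1)/C)²·(L⁻¹)^(2m)·(D m)² ≤ F²` — read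
`hFlat_currency_of_recursion'` at `B0 := D m`. [folklore] -/
theorem hFlat_currency_codepth (L C F : ℝ) (D : ℕ → ℝ) (m : ℕ) (hL : 1 < L) (hC : 0 < C)
    (hDm : 0 ≤ D m) (h : D m ≤ C * F * (L ^ m / (L - 1))) :
    ((L - 1) / C) ^ 2 * (L⁻¹) ^ (2 * m) * D m ^ 2 ≤ F ^ 2 :=
  hFlat_currency_of_recursion' L C F (D m) m hL hC hDm h

/-! ## §5. The VARIABLE-RATIO edition (v1.2 append; px12 g23's F₂ LOCATE 07:12Z + px8 g21 07:14Z (2)(3))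

Non-abelianly the geodesic hat lift of a flat coarse field is not flat (BCH commutator = SIZE × ARC), so the honest
recursion of §57.8 (B) is `B_t ≤ √L·(1 + ε_t)·B_{t+1} + R_t` with `ε_t = C·L·s_t` SUMMABLE (px10 g21's iterated axial
gauge: `s_t ≤ C_P·Σ_{i≥t} θ_i`, `θ_i` geometric).  The product of the ratios is then `≤ L^{t/2}·exp(Σ ε)`: the flap
costs one DEPTH-FREE factor `exp E`, nothing else. -/

/-- the variable-ratio recursion solved over `k` steps: `B t ≤ q t·B (t+1) + R t` on `s ≤ t < s+k`, `0 ≤ q` ⟹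
`B s ≤ (Π_{i<k} q (s+i))·B (s+k) + Σ_{i<k} (Π_{l<i} q (s+l))·R (s+i)`. [folklore] -/
theorem recursion_varRatio_le_prod_mul_add_sum (q B R : ℕ → ℝ) (hq : ∀ t, 0 ≤ q t) (s k : ℕ)
    (hrec : ∀ t, s ≤ t → t < s + k → B t ≤ q t * B (t + 1) + R t) :
    B s ≤ (∏ i ∈ range k, q (s + i)) * B (s + k)
      + ∑ i ∈ range k, (∏ l ∈ range i, q (s + l)) * R (s + i) := by
  induction k with
  | zero => simp
  | succ k ih =>
    have h1 := ih (fun t ht1 ht2 => hrec t ht1 (by omega))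
    have h0 : B (s + k) ≤ q (s + k) * B (s + k + 1) + R (s + k) := hrec (s + k) (by omega) (by omega)
    have hP : 0 ≤ ∏ i ∈ range k, q (s + i) := Finset.prod_nonneg fun i _ => hq (s + i)
    have h2 : (∏ i ∈ range k, q (s + i)) * B (s + k)
        ≤ (∏ i ∈ range k, q (s + i)) * (q (s + k) * B (s + k + 1) + R (s + k)) :=
      mul_le_mul_of_nonneg_left h0 hP
    have h3 : (∏ i ∈ range k, q (s + i)) * (q (s + k) * B (s + k + 1) + R (s + k))
        = (∏ i ∈ range k, q (s + i)) * q (s + k) * B (s + k + 1)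
          + (∏ i ∈ range k, q (s + i)) * R (s + k) := by ring
    rw [Finset.prod_range_succ, Finset.sum_range_succ]
    have e1 : s + (k + 1) = s + k + 1 := by omega
    rw [e1]
    linarith [h1, h2, h3]

/-- ★ THE VARIABLE-RATIO RECURSION WITH VANISHING TOP: `B m = 0`, `B t ≤ q t·B (t+1) + R t` (`t < m`), `0 ≤ q`
⟹ `B 0 ≤ Σ_{t<m} (Π_{i<t} q i)·R t`. [folklore] -/
theorem recursion_varRatio_le_sum (q B R : ℕ → ℝ) (hq : ∀ t, 0 ≤ q t) (m : ℕ) (hB : B m = 0)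
    (hrec : ∀ t, t < m → B t ≤ q t * B (t + 1) + R t) :
    B 0 ≤ ∑ t ∈ range m, (∏ i ∈ range t, q i) * R t := by
  have h := recursion_varRatio_le_prod_mul_add_sum q B R hq 0 m (fun t _ ht => hrec t (by omega))
  simp only [zero_add, hB, mul_zero] at h
  exact h

/-- the product of ratios `c·(1 + ε_i)` with `0 ≤ c`, `0 ≤ ε_i`: `Π_{i<t} c·(1 + ε i) ≤ c^t·exp(Σ_{i<t} ε i)`
(`1 + x ≤ exp x`). [folklore] -/
theorem prod_mul_one_add_le_pow_mul_exp (c : ℝ) (hc : 0 ≤ c) (ε : ℕ → ℝ) (hε : ∀ i, 0 ≤ ε i) (t : ℕ) :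
    ∏ i ∈ range t, c * (1 + ε i) ≤ c ^ t * Real.exp (∑ i ∈ range t, ε i) := by
  rw [Finset.prod_mul_distrib, Finset.prod_const, Finset.card_range, Real.exp_sum]
  refine mul_le_mul_of_nonneg_left ?_ (pow_nonneg hc t)
  refine Finset.prod_le_prod (fun i _ => by linarith [hε i]) fun i _ => ?_
  have h := Real.add_one_le_exp (ε i)
  linarith

/-- the same under a uniform budget `Σ_{i<m} ε i ≤ E`, for every `t ≤ m`: `Π_{i<t} c·(1 + ε i) ≤ c^t·exp E`.
[folklore] -/
theorem prod_mul_one_add_le_pow_mul_exp_of_sum_le (c : ℝ) (hc : 0 ≤ c) (ε : ℕ → ℝ) (hε : ∀ i, 0 ≤ ε i)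
    (m : ℕ) (E : ℝ) (hE : ∑ i ∈ range m, ε i ≤ E) (t : ℕ) (ht : t ≤ m) :
    ∏ i ∈ range t, c * (1 + ε i) ≤ c ^ t * Real.exp E := by
  refine (prod_mul_one_add_le_pow_mul_exp c hc ε hε t).trans ?_
  refine mul_le_mul_of_nonneg_left (Real.exp_le_exp.mpr ?_) (pow_nonneg hc t)
  refine le_trans ?_ hE
  exact Finset.sum_le_sum_of_subset_of_nonneg (Finset.range_subset_range.mpr ht)
    (fun i _ _ => hε i)

/-- ★★ THE VARIABLE-RATIO `√L` RECURSION: `B m = 0`, `B t ≤ √L·(1 + ε t)·B (t+1) + R t` with `0 ≤ ε`,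
`Σ_{t<m} ε t ≤ E`, and `R t ≤ C·(√L)^t·F` (`0 ≤ C`, `0 ≤ F`, `1 < L`) ⟹ `B 0 ≤ exp E·C·F·(L^m − 1)/(L − 1)` — the
summable flap defect costs exactly the depth-free factor `exp E`. [folklore] -/
theorem recursion_varRatio_sqrtL_le (L : ℝ) (hL : 1 < L) (B R ε : ℕ → ℝ) (m : ℕ) (hB : B m = 0)
    (hε : ∀ t, 0 ≤ ε t) (E : ℝ) (hE : ∑ t ∈ range m, ε t ≤ E)
    (hrec : ∀ t, t < m → B t ≤ Real.sqrt L * (1 + ε t) * B (t + 1) + R t) (C F : ℝ) (hC : 0 ≤ C)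
    (hF : 0 ≤ F) (hR : ∀ t, t < m → R t ≤ C * Real.sqrt L ^ t * F) :
    B 0 ≤ Real.exp E * C * F * ((L ^ m - 1) / (L - 1)) := by
  have hL0 : 0 ≤ L := by linarith
  have hq : ∀ t, 0 ≤ Real.sqrt L * (1 + ε t) := fun t =>
    mul_nonneg (Real.sqrt_nonneg L) (by linarith [hε t])
  have h := recursion_varRatio_le_sum (fun t => Real.sqrt L * (1 + ε t)) B R hq m hB hrec
  refine h.trans ?_
  have hterm : ∀ t ∈ range m, (∏ i ∈ range t, Real.sqrt L * (1 + ε i)) * R t ≤ Real.exp E * C * F * L ^ t := by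
    intro t ht
    have ht' : t < m := Finset.mem_range.mp ht
    have hP0 : 0 ≤ ∏ i ∈ range t, Real.sqrt L * (1 + ε i) := Finset.prod_nonneg fun i _ => hq i
    have hP : ∏ i ∈ range t, Real.sqrt L * (1 + ε i) ≤ Real.sqrt L ^ t * Real.exp E :=
      prod_mul_one_add_le_pow_mul_exp_of_sum_le (Real.sqrt L) (Real.sqrt_nonneg L) ε hε m E hE t ht'.le
    have hRt : 0 ≤ C * Real.sqrt L ^ t * F := by positivity
    calc (∏ i ∈ range t, Real.sqrt L * (1 + ε i)) * R t
        ≤ (∏ i ∈ range t, Real.sqrt L * (1 + ε i)) * (C * Real.sqrt L ^ t * F) :=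
          mul_le_mul_of_nonneg_left (hR t ht') hP0
      _ ≤ (Real.sqrt L ^ t * Real.exp E) * (C * Real.sqrt L ^ t * F) :=
          mul_le_mul_of_nonneg_right hP hRt
      _ = Real.exp E * C * F * (Real.sqrt L ^ t * Real.sqrt L ^ t) := by ring
      _ = Real.exp E * C * F * L ^ t := by rw [← mul_pow, Real.mul_self_sqrt hL0]
  calc ∑ t ∈ range m, (∏ i ∈ range t, Real.sqrt L * (1 + ε i)) * R t
      ≤ ∑ t ∈ range m, Real.exp E * C * F * L ^ t := Finset.sum_le_sum hterm
    _ = Real.exp E * C * F * ∑ t ∈ range m, L ^ t := by rw [Finset.mul_sum]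
    _ = Real.exp E * C * F * ((L ^ m - 1) / (L - 1)) := by rw [geom_sum_eq_div L (ne_of_gt hL) m]

/-- the cruder `L^m/(L − 1)` form, so that `hFlat_currency_of_recursion'` applies VERBATIM with the constant
`exp E·C` (`0 < exp E·C` when `0 < C`). [folklore] -/
theorem recursion_varRatio_sqrtL_le_pow (L : ℝ) (hL : 1 < L) (B R ε : ℕ → ℝ) (m : ℕ) (hB : B m = 0)
    (hε : ∀ t, 0 ≤ ε t) (E : ℝ) (hE : ∑ t ∈ range m, ε t ≤ E)
    (hrec : ∀ t, t < m → B t ≤ Real.sqrt L * (1 + ε t) * B (t + 1) + R t) (C F : ℝ) (hC : 0 ≤ C)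
    (hF : 0 ≤ F) (hR : ∀ t, t < m → R t ≤ C * Real.sqrt L ^ t * F) :
    B 0 ≤ (Real.exp E * C) * F * (L ^ m / (L - 1)) := by
  have h := recursion_varRatio_sqrtL_le L hL B R ε m hB hε E hE hrec C F hC hF hR
  have hL1 : 0 < L - 1 := by linarith
  have hgeom : (L ^ m - 1) / (L - 1) ≤ L ^ m / (L - 1) := div_le_div_of_nonneg_right (by linarith) hL1.le
  have h0 : 0 ≤ Real.exp E * C * F := by positivity
  calc B 0 ≤ Real.exp E * C * F * ((L ^ m - 1) / (L - 1)) := h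
    _ ≤ Real.exp E * C * F * (L ^ m / (L - 1)) := mul_le_mul_of_nonneg_left hgeom h0
    _ = (Real.exp E * C) * F * (L ^ m / (L - 1)) := by ring

/-- ★★ CODEPTH twin of the variable-ratio `√L` recursion (top at `k = 0`): `D 0 = 0`,
`D (k+1) ≤ √L·(1 + ε′ k)·D k + R′ k`, `Σ_{k<m} ε′ k ≤ E`, `R′ k ≤ C·(√L)^(m−1−k)·F`
⟹ `D m ≤ exp E·C·F·(L^m − 1)/(L − 1)`. [folklore] -/
theorem recursion_codepth_varRatio_sqrtL_le (L : ℝ) (hL : 1 < L) (D R' ε' : ℕ → ℝ) (m : ℕ) (hD : D 0 = 0)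
    (hε : ∀ k, 0 ≤ ε' k) (E : ℝ) (hE : ∑ k ∈ range m, ε' k ≤ E)
    (hrec : ∀ k, k < m → D (k + 1) ≤ Real.sqrt L * (1 + ε' k) * D k + R' k) (C F : ℝ) (hC : 0 ≤ C)
    (hF : 0 ≤ F) (hR : ∀ k, k < m → R' k ≤ C * Real.sqrt L ^ (m - 1 - k) * F) :
    D m ≤ Real.exp E * C * F * ((L ^ m - 1) / (L - 1)) := by
  have hB : (fun t => D (m - t)) m = 0 := by simp [hD]
  have hE' : ∑ t ∈ range m, (fun t => ε' (m - 1 - t)) t ≤ E := by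
    rw [Finset.sum_range_reflect (fun k => ε' k) m]
    exact hE
  have h := recursion_varRatio_sqrtL_le L hL (fun t => D (m - t)) (fun t => R' (m - 1 - t))
    (fun t => ε' (m - 1 - t)) m hB (fun t => hε _) E hE'
    (by
      intro t ht
      have e1 : m - t = (m - (t + 1)) + 1 := by omega
      have e2 : m - 1 - t = m - (t + 1) := by omega
      show D (m - t) ≤ Real.sqrt L * (1 + ε' (m - 1 - t)) * D (m - (t + 1)) + R' (m - 1 - t)
      rw [e1, e2]
      exact hrec (m - (t + 1)) (by omega))
    C F hC hF (by
      intro t ht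
      have e3 : m - 1 - (m - 1 - t) = t := by omega
      have h1 := hR (m - 1 - t) (by omega)
      rw [e3] at h1
      exact h1)
  simpa using h

end Summit.QuantumFields.YangMills.Theorems.FluctuationComparisonRegPrIntLS2BetaSqrtLRecursion
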